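import Summits.AtomisticToContinuum.HydrodynamicLimit.Theorems.EnskogAdjointDualityDualityReductionAssembly
import HarnessLib

/-!
# EnskogAdjointDuality / CollisionResidualVanishes — the duality identity solved for the residual

Support lemmas for the crux `Summit.AtomisticToContinuum.HydrodynamicLimit.Theses.EnskogAdjointDuality.CollisionResidualVanishes`
(stmt-AtomisticToContinuum-14658, line `birth`). The route's duality glue (`pathwise_duality_bound`,
`duality_assembly`) reads the EXACT pathwise identity of the empirical measure along a good orbit,

`A_t − B_t = (A_0 − B_0) + ∫₀ᵗ ⟨μ_s, (D + L_s)φ_s⟩ ds − (I₃ + ½I₂) + 𝓡 − Res`,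

from right to left: collision residual `𝓡 → 0` (crux K1) ⇒ `A_t − B_t → 0` (the tested hydrodynamic
quantity). Here the same identity is read from LEFT TO RIGHT, solved for the collision residual:

`|𝓡| ≤ |A_t − B_t| + |A_0 − B_0| + η t (1 + e(z)) + |I₃ + ½I₂| + |Res|`,

so that mean-square convergence of the tested hydrodynamic quantity AT TIME `t` implies
`∫ 𝓡² dP_N → 0` for every approximately-dual test family (the converse glue; the route-vocabulary
statement is `collisionResidual_tendsto_zero_of_tendstoHydroFieldsAt` in the companion file
`EnskogAdjointDualityCollisionResidualVanishesConverse.lean`).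

* `pathwise_residual_bound` — the deterministic estimate above (hypotheses of `pathwise_duality_bound`);
* `residual_assembly` — the `L²` converse of `duality_assembly`: (a) `C¹`-regularity along free
  flight and defect `|Dφ^N + L^Nφ^N| ≤ η_N(1+|v|²)` eventually, `η_N → 0`; (c) Enskog defect of `f`
  tested on the family `→ 0`; (d) `I₃ + ½I₂ → 0`; (e) the `t = 0` term `→ 0` in `L²(P_N)`; and
  (b') `⟨μ^N_t, φ^N_t⟩ − ∫∫ f_t φ^N_t → 0` in `L²(P_N)` — imply `∫ 𝓡_N² dP_N → 0`.

Not here: any dynamics beyond the exact identity (no chaos / local-equilibrium input is used).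

References: M. Pulvirenti, S. Simonella, arXiv:1504.03215, §2 [PulvirentiSimonella2016];
T. Bodineau, I. Gallagher, L. Saint-Raymond, Ann. PDE 3 (2017) [BGSR2017]; H. Spohn (1991),
Part I §3.2 [Spohn1991].
-/

noncomputable section

open MeasureTheory Set Filter Topology Function
open scoped ENNReal BigOperators InnerProductSpace

namespace Summit.AtomisticToContinuum.HydrodynamicLimit.Theorems

open Literature.Analysis.FluidPDE Literature.MathematicalPhysics.KineticTheory

variable {N : ℕ} {ε : ℝ}

/-! ## The pathwise estimate, solved for the collision residual -/

/-- **The pathwise duality identity solved for the collision residual.** For a good datum `z` of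
a hard-sphere flow of `N + 1` spheres on `𝕋³`, `0 < t`, a test function `φ` that is `C¹` along
free flight on `[0, t]` with defect `|Dφ + Lφ| ≤ η(1+|v|²)` there, the collision-operator term
integrable along the orbit, and real numbers tied by the bookkeeping of the route —
`R = (N+1)⁻¹ C − I₁ + ½I₂` with `C` the collision sum of `φ`-increments over `(0, t]` and
`I₁ = ∫₀ᵗ⟨μ_s, L_s⟩`, `Res = B_t − B_0 − I₃` — one has
`|R| ≤ |A_t − B_t| + |A_0 − B_0| + η t (1 + e(z)) + |I₃ + ½I₂| + |Res|`,
`A_s = (N+1)⁻¹ Σᵢ φ(s, zᵢ(s))`, `e(z) = (N+1)⁻¹Σᵢ|vᵢ|²` (the exact empirical identity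
`A_t − B_t = (A_0 − B_0) + ∫⟨μ_s,(D+L)φ⟩ − (I₃+½I₂) + R − Res` of `pathwise_duality_bound`, read
from left to right). [cite: PulvirentiSimonella2016, §2] -/
theorem pathwise_residual_bound (Φ : HardSphereFlow (Torus.geometry (Fin 3)) ε (N + 1))
    {z : Config (N + 1) (Fin 3) T3} (hz : z ∈ Φ.good) {t : ℝ} (ht : 0 < t)
    (φ L : ℝ → T3 → V3 → ℝ) {η : ℝ}
    (hφ : ∀ x v, ContDiffOn ℝ 1
      (fun r => φ r ((Torus.geometry (Fin 3)).translate x (r • v)) v) (Icc 0 t))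
    (hDL : ∀ s ∈ Icc 0 t, ∀ x v,
      |derivWithin (fun r => φ r ((Torus.geometry (Fin 3)).translate x ((r - s) • v)) v) (Icc 0 t) s +
        L s x v| ≤ η * (1 + ‖v‖ ^ 2))
    (hLint : IntegrableOn (fun s => ∫ y, L s y.1 y.2 ∂(empiricalMeasure (Φ.flow s z))) (Icc 0 t))
    {Rz Res I₂ I₃ Bt B0 : ℝ}
    (hR : Rz = ((N : ℝ) + 1)⁻¹ *
        (∑ᶠ (s : ℝ) (_ : s ∈ collisionTimes (Torus.geometry (Fin 3)) ε (fun r => Φ.flow r z) ∩ Ioc 0 t),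
          ∑ i : Fin (N + 1), ∑ j : Fin (N + 1),
            (if i ≠ j ∧ ‖(Torus.geometry (Fin 3)).sepVec (Φ.flow s z i).1 (Φ.flow s z j).1‖ = ε then
              φ s (Φ.flow s z i).1 (Φ.flow s z i).2 -
                φ s (Φ.flow s z i).1
                  (reflectVel ((Torus.geometry (Fin 3)).sepVec (Φ.flow s z i).1 (Φ.flow s z j).1)
                    ((Φ.flow s z i).2, (Φ.flow s z j).2)).1
            else 0)) -
        (∫ s in Icc 0 t, ∫ y, L s y.1 y.2 ∂(empiricalMeasure (Φ.flow s z))) + (1 / 2 : ℝ) * I₂)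
    (hRes : Res = Bt - B0 - I₃) :
    |Rz| ≤ |((N : ℝ) + 1)⁻¹ * (∑ i, φ t (Φ.flow t z i).1 (Φ.flow t z i).2) - Bt| +
      |((N : ℝ) + 1)⁻¹ * (∑ i, φ 0 (z i).1 (z i).2) - B0| +
        η * t * (1 + ((N + 1 : ℕ) : ℝ)⁻¹ * ∑ i, ‖(z i).2‖ ^ 2) +
        |I₃ + (1 / 2 : ℝ) * I₂| + |Res| := by
  obtain ⟨hDint, hbal⟩ := empirical_balance_Icc Φ hz ht φ hφ
  -- abbreviations
  set n : ℝ := (N : ℝ) + 1 with hn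
  have hn' : ((N + 1 : ℕ) : ℝ) = n := by rw [hn]; push_cast; ring
  have hnpos : 0 < n := by rw [hn]; positivity
  set At : ℝ := n⁻¹ * ∑ i, φ t (Φ.flow t z i).1 (Φ.flow t z i).2 with hAt
  set A0 : ℝ := n⁻¹ * ∑ i, φ 0 (z i).1 (z i).2 with hA0
  set Dsum : ℝ → ℝ := fun s => ∑ i, derivWithin
      (fun r => φ r ((Torus.geometry (Fin 3)).translate (Φ.flow s z i).1
        ((r - s) • (Φ.flow s z i).2)) (Φ.flow s z i).2) (Icc 0 t) s with hDsum
  set Lsum : ℝ → ℝ := fun s => ∫ y, L s y.1 y.2 ∂(empiricalMeasure (Φ.flow s z)) with hLsum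
  set Csum : ℝ := ∑ᶠ (s : ℝ) (_ : s ∈ collisionTimes (Torus.geometry (Fin 3)) ε (fun r => Φ.flow r z) ∩ Ioc 0 t),
      ∑ i : Fin (N + 1), ∑ j : Fin (N + 1),
        (if i ≠ j ∧ ‖(Torus.geometry (Fin 3)).sepVec (Φ.flow s z i).1 (Φ.flow s z j).1‖ = ε then
          φ s (Φ.flow s z i).1 (Φ.flow s z i).2 -
            φ s (Φ.flow s z i).1
              (reflectVel ((Torus.geometry (Fin 3)).sepVec (Φ.flow s z i).1 (Φ.flow s z j).1)
                ((Φ.flow s z i).2, (Φ.flow s z j).2)).1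
        else 0) with hCsum
  set I₁ : ℝ := ∫ s in Icc 0 t, Lsum s with hI₁
  -- the balance law, divided by `n`
  have hbal' : At - A0 = n⁻¹ * (∫ s in Icc 0 t, Dsum s) + n⁻¹ * Csum := by
    have hb : (∑ i, φ t (Φ.flow t z i).1 (Φ.flow t z i).2) - (∑ i, φ 0 (z i).1 (z i).2) =
        (∫ s in Icc 0 t, Dsum s) + Csum := by
      rw [integral_Icc_eq_integral_Ioc, ← intervalIntegral.integral_of_le ht.le]
      exact hbal
    simp only [hAt, hA0]
    rw [← mul_sub, hb, mul_add]
  -- the merged transport + collision-operator integral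
  have hLsum_eq : ∀ s, Lsum s = ((N + 1 : ℕ) : ℝ)⁻¹ * ∑ i, L s (Φ.flow s z i).1 (Φ.flow s z i).2 :=
    fun s => integral_empiricalMeasure (Φ.flow s z) (fun y => L s y.1 y.2)
  have hDintOn : IntegrableOn Dsum (Icc 0 t) := by
    rw [integrableOn_Icc_iff_integrableOn_Ioc]
    exact (intervalIntegrable_iff_integrableOn_Ioc_of_le ht.le).1 hDint
  have hmerge : n⁻¹ * (∫ s in Icc 0 t, Dsum s) + I₁ = ∫ s in Icc 0 t, (n⁻¹ * Dsum s + Lsum s) := by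
    rw [integral_add (hDintOn.const_mul _) hLint, integral_const_mul]
  have henergy : ∀ s, ∑ i, ‖(Φ.flow s z i).2‖ ^ 2 = ∑ i, ‖(z i).2‖ ^ 2 :=
    fun s => sum_norm_sq_vel_flow Φ hz s
  have hptw : ∀ s ∈ Icc 0 t, ‖n⁻¹ * Dsum s + Lsum s‖ ≤
      η * (1 + ((N + 1 : ℕ) : ℝ)⁻¹ * ∑ i, ‖(z i).2‖ ^ 2) := by
    intro s hs
    have e1 : n⁻¹ * Dsum s + Lsum s = n⁻¹ * ∑ i, (derivWithin
        (fun r => φ r ((Torus.geometry (Fin 3)).translate (Φ.flow s z i).1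
          ((r - s) • (Φ.flow s z i).2)) (Φ.flow s z i).2) (Icc 0 t) s +
        L s (Φ.flow s z i).1 (Φ.flow s z i).2) := by
      rw [hLsum_eq s, hn', ← mul_add, ← Finset.sum_add_distrib]
    rw [e1, hn', Real.norm_eq_abs, abs_mul, abs_of_pos (inv_pos.2 hnpos)]
    calc n⁻¹ * |∑ i, (derivWithin
          (fun r => φ r ((Torus.geometry (Fin 3)).translate (Φ.flow s z i).1
            ((r - s) • (Φ.flow s z i).2)) (Φ.flow s z i).2) (Icc 0 t) s +
          L s (Φ.flow s z i).1 (Φ.flow s z i).2)|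
        ≤ n⁻¹ * ∑ i, |derivWithin
          (fun r => φ r ((Torus.geometry (Fin 3)).translate (Φ.flow s z i).1
            ((r - s) • (Φ.flow s z i).2)) (Φ.flow s z i).2) (Icc 0 t) s +
          L s (Φ.flow s z i).1 (Φ.flow s z i).2| := by
          gcongr; exact Finset.abs_sum_le_sum_abs _ _
      _ ≤ n⁻¹ * ∑ i, η * (1 + ‖(Φ.flow s z i).2‖ ^ 2) := by
          gcongr with i; exact hDL s hs _ _
      _ = η * (1 + n⁻¹ * ∑ i, ‖(z i).2‖ ^ 2) := by
          rw [← henergy s, ← Finset.mul_sum, Finset.sum_add_distrib, Finset.sum_const,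
            Finset.card_univ, Fintype.card_fin, nsmul_eq_mul, mul_one, hn']
          field_simp
  have hmergebd : |n⁻¹ * (∫ s in Icc 0 t, Dsum s) + I₁| ≤
      η * t * (1 + ((N + 1 : ℕ) : ℝ)⁻¹ * ∑ i, ‖(z i).2‖ ^ 2) := by
    rw [hmerge]
    have h := norm_setIntegral_le_of_norm_le_const (μ := (volume : Measure ℝ)) (s := Icc 0 t)
      (f := fun s => n⁻¹ * Dsum s + Lsum s) (by rw [Real.volume_Icc]; exact ENNReal.ofReal_lt_top) hptw
    rw [Real.norm_eq_abs, Real.volume_real_Icc_of_le ht.le, sub_zero] at h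
    refine h.trans (le_of_eq ?_)
    ring
  -- bookkeeping: the exact identity, solved for the residual
  have hRz : Rz = n⁻¹ * Csum - I₁ + (1 / 2 : ℝ) * I₂ := by rw [hR]
  have hkey : Rz = (At - Bt) - (A0 - B0) - (n⁻¹ * (∫ s in Icc 0 t, Dsum s) + I₁) +
      (I₃ + (1 / 2 : ℝ) * I₂) + Res := by
    rw [hRz, hRes]
    linarith [hbal']
  rw [hkey]
  have h5 : ∀ a b c d e : ℝ, |a - b - c + d + e| ≤ |a| + |b| + |c| + |d| + |e| := by
    intro a b c d e
    calc |a - b - c + d + e| ≤ |a - b - c + d| + |e| := abs_add_le _ _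
      _ ≤ |a - b - c| + |d| + |e| := by gcongr; exact abs_add_le _ _
      _ ≤ |a - b| + |c| + |d| + |e| := by gcongr; exact abs_sub _ _
      _ ≤ |a| + |b| + |c| + |d| + |e| := by gcongr; exact abs_sub _ _
  refine (h5 _ _ _ _ _).trans ?_
  gcongr

/-! ## The `L²` converse of the duality assembly -/

variable {a₀ θ₀ : T3 → ℝ} {u₀ : T3 → V3}

/-- `(a + b + c + d + e)² ≤ 5 (a² + b² + c² + d² + e²)`. [folklore] -/
private theorem sq_add_five_le (a b c d e : ℝ) :
    (a + b + c + d + e) ^ 2 ≤ 5 * (a ^ 2 + b ^ 2 + c ^ 2 + d ^ 2 + e ^ 2) := by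
  nlinarith [sq_nonneg (a - b), sq_nonneg (a - c), sq_nonneg (a - d), sq_nonneg (a - e),
    sq_nonneg (b - c), sq_nonneg (b - d), sq_nonneg (b - e), sq_nonneg (c - d), sq_nonneg (c - e),
    sq_nonneg (d - e)]

/-- Real sequences tending to `0` have `ENNReal.ofReal` of their squares tending to `0`.
[folklore] -/
private theorem tendsto_ofReal_sq_of_tendsto_zero {g : ℕ → ℝ} (hg : Tendsto g atTop (𝓝 0)) :
    Tendsto (fun N => ENNReal.ofReal (g N ^ 2)) atTop (𝓝 0) := by
  have h : Tendsto (fun N => g N ^ 2) atTop (𝓝 0) := by simpa using hg.pow 2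
  simpa using ENNReal.tendsto_ofReal h

/-- **The `L²` converse of the duality assembly.** For a family of test functions `φ^N`
(continuous), kernels `L^N` (growth `(1+|v|²)²` on `[0, t]`, measurable after freezing time) and
the Euler local Maxwellian weight `f`: (a) `C¹`-regularity along free flight and the defect bound
`|Dφ^N + L^Nφ^N| ≤ η_N(1+|v|²)` on `[0, t]` eventually, `η_N → 0`; (c) the Enskog defect of `f`
tested on the family `→ 0`; (d) the Euler-side combination `I₃ + ½I₂ → 0`; (e) the `t = 0` term
`→ 0` in `L²(P_N)`; and (b') the TESTED HYDRODYNAMIC QUANTITY AT TIME `t` converges,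
`⟨μ^N_t, φ^N_t⟩ − ∫∫ f_t φ^N_t → 0` in `L²(P_N)` — then the collision residual `R_N` (in the route's
literal form) satisfies `∫ R_N² dP_N → 0` under the local Gibbs laws (`σ ≤ 1/2`). This is
`duality_assembly` with the roles of the residual and of the time-`t` term exchanged
(`pathwise_residual_bound`). [cite: PulvirentiSimonella2016, §2] -/
theorem residual_assembly (ha : Continuous a₀) (hθ : Continuous θ₀) (hu : Continuous u₀)
    (ha0 : ∀ x, 0 < a₀ x) (hθ0 : ∀ x, 0 < θ₀ x) {σ : ℝ} (hσ : σ ≤ 1 / 2)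
    (Φ : (N : ℕ) → HardSphereFlow (Torus.geometry (Fin 3)) (hsDiameter σ N) (N + 1))
    {t : ℝ} (ht : 0 < t)
    (φ L : ℕ → ℝ → T3 → V3 → ℝ) (f : ℝ → T3 → V3 → ℝ)
    (Rres : (N : ℕ) → Config (N + 1) (Fin 3) T3 → ℝ)
    (hφc : ∀ N, Continuous fun p : ℝ × T3 × V3 => φ N p.1 p.2.1 p.2.2)
    (hreg : ∃ η : ℕ → ℝ, Tendsto η atTop (𝓝 0) ∧ ∀ᶠ N in atTop,
      (∀ x v, ContDiffOn ℝ 1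
        (fun r => φ N r ((Torus.geometry (Fin 3)).translate x (r • v)) v) (Icc 0 t)) ∧
      (∀ s ∈ Icc 0 t, ∀ x v,
        |derivWithin (fun r => φ N r ((Torus.geometry (Fin 3)).translate x ((r - s) • v)) v)
            (Icc 0 t) s + L N s x v| ≤ η N * (1 + ‖v‖ ^ 2)))
    (hL : ∀ N, ∃ K : ℝ, (∀ s ∈ Icc 0 t, ∀ x v, |L N s x v| ≤ K * (1 + ‖v‖ ^ 2) ^ 2) ∧
      Measurable fun p : ℝ × T3 × V3 => L N (max 0 (min t p.1)) p.2.1 p.2.2)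
    (hR : ∀ N z, Rres N z = ((N : ℝ) + 1)⁻¹ *
        (∑ᶠ (s : ℝ) (_ : s ∈ collisionTimes (Torus.geometry (Fin 3)) (hsDiameter σ N)
            (fun r => (Φ N).flow r z) ∩ Ioc 0 t),
          ∑ i : Fin (N + 1), ∑ j : Fin (N + 1),
            (if i ≠ j ∧ ‖(Torus.geometry (Fin 3)).sepVec ((Φ N).flow s z i).1 ((Φ N).flow s z j).1‖ =
                hsDiameter σ N then
              φ N s ((Φ N).flow s z i).1 ((Φ N).flow s z i).2 -
                φ N s ((Φ N).flow s z i).1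
                  (reflectVel ((Torus.geometry (Fin 3)).sepVec ((Φ N).flow s z i).1 ((Φ N).flow s z j).1)
                    (((Φ N).flow s z i).2, ((Φ N).flow s z j).2)).1
            else 0)) -
        (∫ s in Icc 0 t, ∫ y, L N s y.1 y.2 ∂(empiricalMeasure ((Φ N).flow s z))) +
        (1 / 2 : ℝ) * ∫ s in Icc 0 t, ∫ x, ∫ v, f s x v * L N s x v)
    (hAt : Tendsto (fun N => ∫⁻ z, ENNReal.ofReal
      ((((N : ℝ) + 1)⁻¹ * (∑ i, φ N t ((Φ N).flow t z i).1 ((Φ N).flow t z i).2) -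
        ∫ x, ∫ v, f t x v * φ N t x v) ^ 2)
      ∂localGibbsLaw σ a₀ u₀ θ₀ N (Φ N)) atTop (𝓝 0))
    (hRes : Tendsto (fun N => (∫ x, ∫ v, f t x v * φ N t x v) - (∫ x, ∫ v, f 0 x v * φ N 0 x v) -
      ∫ s in Icc 0 t, ∫ x, ∫ v, f s x v *
        (derivWithin (fun r => φ N r ((Torus.geometry (Fin 3)).translate x ((r - s) • v)) v)
          (Icc 0 t) s + (1 / 2 : ℝ) * L N s x v)) atTop (𝓝 0))
    (hF : Tendsto (fun N => (∫ s in Icc 0 t, ∫ x, ∫ v, f s x v *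
        (derivWithin (fun r => φ N r ((Torus.geometry (Fin 3)).translate x ((r - s) • v)) v)
          (Icc 0 t) s + (1 / 2 : ℝ) * L N s x v)) +
      (1 / 2 : ℝ) * ∫ s in Icc 0 t, ∫ x, ∫ v, f s x v * L N s x v) atTop (𝓝 0))
    (h0 : Tendsto (fun N => ∫⁻ z, ENNReal.ofReal
      ((((N : ℝ) + 1)⁻¹ * (∑ i, φ N 0 (z i).1 (z i).2) - ∫ x, ∫ v, f 0 x v * φ N 0 x v) ^ 2)
      ∂localGibbsLaw σ a₀ u₀ θ₀ N (Φ N)) atTop (𝓝 0)) :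
    Tendsto (fun N => ∫⁻ z, ENNReal.ofReal (Rres N z ^ 2)
      ∂localGibbsLaw σ a₀ u₀ θ₀ N (Φ N)) atTop (𝓝 0) := by
  obtain ⟨η, hη, hev⟩ := hreg
  haveI hP : ∀ N, IsProbabilityMeasure (localGibbsLaw σ a₀ u₀ θ₀ N (Φ N)) := fun N =>
    isProbabilityMeasure_localGibbsLaw ha hθ hu ha0 hθ0 hσ N (Φ N)
  -- the conserved-energy moment bound, flow-free
  obtain ⟨Cm, hCm0, hCm⟩ := lintegral_one_add_energy_pow_four_flow_le ha hθ hu ha0 hθ0 hσ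
  have hmom : ∀ N, ∫⁻ z, ENNReal.ofReal ((1 + ((N + 1 : ℕ) : ℝ)⁻¹ * ∑ i, ‖(z i).2‖ ^ 2) ^ 2)
      ∂localGibbsLaw σ a₀ u₀ θ₀ N (Φ N) ≤ ENNReal.ofReal Cm := by
    intro N
    have hgood : ∀ᵐ z ∂localGibbsLaw σ a₀ u₀ θ₀ N (Φ N), z ∈ (Φ N).good :=
      mem_ae_iff.2 (localGibbsLaw_compl_good_eq_zero (Φ N))
    calc ∫⁻ z, ENNReal.ofReal ((1 + ((N + 1 : ℕ) : ℝ)⁻¹ * ∑ i, ‖(z i).2‖ ^ 2) ^ 2)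
          ∂localGibbsLaw σ a₀ u₀ θ₀ N (Φ N)
        = ∫⁻ z, ENNReal.ofReal ((1 + ((N + 1 : ℕ) : ℝ)⁻¹ * ∑ i, ‖((Φ N).flow 0 z i).2‖ ^ 2) ^ 2)
          ∂localGibbsLaw σ a₀ u₀ θ₀ N (Φ N) := by
          refine lintegral_congr_ae ?_
          filter_upwards [hgood] with z hz
          rw [(Φ N).flow_zero z hz]
      _ ≤ ENNReal.ofReal Cm := hCm N (Φ N) 0 2 (by norm_num)
  -- names for the scalar sequences
  set fs : ℕ → ℝ := fun N => (∫ s in Icc 0 t, ∫ x, ∫ v, f s x v *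
      (derivWithin (fun r => φ N r ((Torus.geometry (Fin 3)).translate x ((r - s) • v)) v)
        (Icc 0 t) s + (1 / 2 : ℝ) * L N s x v)) +
    (1 / 2 : ℝ) * ∫ s in Icc 0 t, ∫ x, ∫ v, f s x v * L N s x v with hfs
  set res : ℕ → ℝ := fun N => (∫ x, ∫ v, f t x v * φ N t x v) - (∫ x, ∫ v, f 0 x v * φ N 0 x v) -
      ∫ s in Icc 0 t, ∫ x, ∫ v, f s x v *
        (derivWithin (fun r => φ N r ((Torus.geometry (Fin 3)).translate x ((r - s) • v)) v)
          (Icc 0 t) s + (1 / 2 : ℝ) * L N s x v) with hres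
  -- the dominating sequence
  set G : ℕ → ℝ≥0∞ := fun N => ENNReal.ofReal 5 *
    ((∫⁻ z, ENNReal.ofReal
        ((((N : ℝ) + 1)⁻¹ * (∑ i, φ N t ((Φ N).flow t z i).1 ((Φ N).flow t z i).2) -
          ∫ x, ∫ v, f t x v * φ N t x v) ^ 2) ∂localGibbsLaw σ a₀ u₀ θ₀ N (Φ N)) +
      ((∫⁻ z, ENNReal.ofReal ((((N : ℝ) + 1)⁻¹ * (∑ i, φ N 0 (z i).1 (z i).2) -
        ∫ x, ∫ v, f 0 x v * φ N 0 x v) ^ 2) ∂localGibbsLaw σ a₀ u₀ θ₀ N (Φ N)) +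
      (ENNReal.ofReal ((η N * t) ^ 2) * ENNReal.ofReal Cm +
      (ENNReal.ofReal (fs N ^ 2) + ENNReal.ofReal (res N ^ 2))))) with hG
  have hGlim : Tendsto G atTop (𝓝 0) := by
    have h2 : Tendsto (fun N => ENNReal.ofReal ((η N * t) ^ 2) * ENNReal.ofReal Cm) atTop (𝓝 0) := by
      have := ENNReal.Tendsto.mul_const (tendsto_ofReal_sq_of_tendsto_zero (by simpa using hη.mul_const t))
        (Or.inr ENNReal.ofReal_ne_top : (0 : ℝ≥0∞) ≠ 0 ∨ ENNReal.ofReal Cm ≠ ⊤)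
      simpa using this
    have h3 : Tendsto (fun N => ENNReal.ofReal (fs N ^ 2)) atTop (𝓝 0) :=
      tendsto_ofReal_sq_of_tendsto_zero hF
    have h4 : Tendsto (fun N => ENNReal.ofReal (res N ^ 2)) atTop (𝓝 0) :=
      tendsto_ofReal_sq_of_tendsto_zero hRes
    have hsum := hAt.add (h0.add (h2.add (h3.add h4)))
    simp only [add_zero] at hsum
    have := ENNReal.Tendsto.const_mul hsum (Or.inr ENNReal.ofReal_ne_top :
      (0 : ℝ≥0∞) ≠ 0 ∨ ENNReal.ofReal 5 ≠ ⊤)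
    simpa [hG] using this
  -- eventually the pathwise estimate applies
  refine tendsto_of_tendsto_of_tendsto_of_le_of_le' tendsto_const_nhds hGlim
    (Eventually.of_forall fun N => bot_le) ?_
  filter_upwards [hev] with N hN
  obtain ⟨hC1, hdef⟩ := hN
  obtain ⟨K, hKb, hKm⟩ := hL N
  have hη0 : 0 ≤ η N := by
    have h := (abs_nonneg _).trans (hdef 0 ⟨le_rfl, ht.le⟩ 0 0)
    simpa using h
  set n : ℝ := (N : ℝ) + 1 with hn
  set B0 : ℝ := ∫ x, ∫ v, f 0 x v * φ N 0 x v with hB0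
  set Bt : ℝ := ∫ x, ∫ v, f t x v * φ N t x v with hBt
  set X0 : Config (N + 1) (Fin 3) T3 → ℝ := fun z =>
    n⁻¹ * (∑ i, φ N 0 (z i).1 (z i).2) - B0 with hX0
  set Xt : Config (N + 1) (Fin 3) T3 → ℝ := fun z =>
    n⁻¹ * (∑ i, φ N t ((Φ N).flow t z i).1 ((Φ N).flow t z i).2) - Bt with hXt
  set en : Config (N + 1) (Fin 3) T3 → ℝ := fun z =>
    ((N + 1 : ℕ) : ℝ)⁻¹ * ∑ i, ‖(z i).2‖ ^ 2 with hen
  -- pointwise a.e. bound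
  have hgood : ∀ᵐ z ∂localGibbsLaw σ a₀ u₀ θ₀ N (Φ N), z ∈ (Φ N).good :=
    mem_ae_iff.2 (localGibbsLaw_compl_good_eq_zero (Φ N))
  have hpt : ∀ᵐ z ∂localGibbsLaw σ a₀ u₀ θ₀ N (Φ N),
      ENNReal.ofReal (Rres N z ^ 2) ≤
        ENNReal.ofReal 5 * (ENNReal.ofReal (Xt z ^ 2) + (ENNReal.ofReal (X0 z ^ 2) +
          (ENNReal.ofReal ((η N * t) ^ 2) * ENNReal.ofReal ((1 + en z) ^ 2) +
          (ENNReal.ofReal (fs N ^ 2) + ENNReal.ofReal (res N ^ 2))))) := by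
    filter_upwards [hgood] with z hz
    have hLint := integrableOn_enskogL_orbit (Φ N) hz (L N) hKb hKm
    have hpw := pathwise_residual_bound (Φ N) hz ht (φ N) (L N) hC1 hdef hLint
      (Rz := Rres N z) (Res := res N) (I₂ := ∫ s in Icc 0 t, ∫ x, ∫ v, f s x v * L N s x v)
      (I₃ := ∫ s in Icc 0 t, ∫ x, ∫ v, f s x v *
        (derivWithin (fun r => φ N r ((Torus.geometry (Fin 3)).translate x ((r - s) • v)) v)
          (Icc 0 t) s + (1 / 2 : ℝ) * L N s x v)) (Bt := Bt) (B0 := B0) (hR N z)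
      (by simp only [hres, hBt, hB0])
    have hen0 : 0 ≤ en z := by positivity
    have hsq : Rres N z ^ 2 ≤
        5 * (Xt z ^ 2 + X0 z ^ 2 + (η N * t) ^ 2 * (1 + en z) ^ 2 + fs N ^ 2 + res N ^ 2) := by
      have h1 : |Rres N z| ≤ |Xt z| + |X0 z| + η N * t * (1 + en z) + |fs N| + |res N| := by
        simpa only [hXt, hX0, hen, hfs] using hpw
      calc Rres N z ^ 2 = |Rres N z| ^ 2 := (sq_abs _).symm
        _ ≤ (|Xt z| + |X0 z| + η N * t * (1 + en z) + |fs N| + |res N|) ^ 2 :=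
            pow_le_pow_left₀ (abs_nonneg _) h1 2
        _ ≤ 5 * (|Xt z| ^ 2 + |X0 z| ^ 2 + (η N * t * (1 + en z)) ^ 2 + |fs N| ^ 2 + |res N| ^ 2) :=
            sq_add_five_le _ _ _ _ _
        _ = 5 * (Xt z ^ 2 + X0 z ^ 2 + (η N * t) ^ 2 * (1 + en z) ^ 2 + fs N ^ 2 + res N ^ 2) := by
            simp only [sq_abs]; ring
    calc ENNReal.ofReal (Rres N z ^ 2)
        ≤ ENNReal.ofReal (5 * (Xt z ^ 2 + X0 z ^ 2 + (η N * t) ^ 2 * (1 + en z) ^ 2 + fs N ^ 2 +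
            res N ^ 2)) := ENNReal.ofReal_le_ofReal hsq
      _ = _ := by
          rw [ENNReal.ofReal_mul (by norm_num), ENNReal.ofReal_add (by positivity) (by positivity),
            ENNReal.ofReal_add (by positivity) (by positivity),
            ENNReal.ofReal_add (by positivity) (by positivity),
            ENNReal.ofReal_add (by positivity) (by positivity), ENNReal.ofReal_mul (by positivity)]
          ring
  -- measurability of the summands that need it
  have hcoord : ∀ i : Fin (N + 1), Measurable fun w : Config (N + 1) (Fin 3) T3 => w i :=
    fun i => measurable_pi_apply i
  have hXtm : Measurable fun z => ENNReal.ofReal (Xt z ^ 2) := by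
    have hsumm : Measurable fun w : Config (N + 1) (Fin 3) T3 => ∑ i, φ N t (w i).1 (w i).2 := by
      refine Finset.measurable_sum _ fun i _ => ?_
      exact (hφc N).measurable.comp (measurable_const.prodMk
        ((hcoord i).fst.prodMk (hcoord i).snd))
    have hm : Measurable Xt :=
      ((hsumm.comp ((Φ N).measurable_flow t)).const_mul _).sub measurable_const
    exact (hm.pow_const 2).ennreal_ofReal
  have hX0m : Measurable fun z => ENNReal.ofReal (X0 z ^ 2) := by
    have hm : Measurable X0 := by
      refine (Measurable.const_mul ?_ _).sub measurable_const
      refine Finset.measurable_sum _ fun i _ => ?_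
      exact (hφc N).measurable.comp (measurable_const.prodMk
        ((hcoord i).fst.prodMk (hcoord i).snd))
    exact (hm.pow_const 2).ennreal_ofReal
  have henm : Measurable fun z => ENNReal.ofReal ((η N * t) ^ 2) * ENNReal.ofReal ((1 + en z) ^ 2) := by
    refine Measurable.const_mul ?_ _
    refine ((measurable_const.add (Measurable.const_mul ?_ _)).pow_const 2).ennreal_ofReal
    exact Finset.measurable_sum _ fun i _ => ((hcoord i).snd.norm).pow_const 2
  -- integrate
  calc ∫⁻ z, ENNReal.ofReal (Rres N z ^ 2) ∂localGibbsLaw σ a₀ u₀ θ₀ N (Φ N)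
      ≤ ∫⁻ z, ENNReal.ofReal 5 * (ENNReal.ofReal (Xt z ^ 2) + (ENNReal.ofReal (X0 z ^ 2) +
          (ENNReal.ofReal ((η N * t) ^ 2) * ENNReal.ofReal ((1 + en z) ^ 2) +
          (ENNReal.ofReal (fs N ^ 2) + ENNReal.ofReal (res N ^ 2))))) ∂localGibbsLaw σ a₀ u₀ θ₀ N (Φ N) :=
        lintegral_mono_ae hpt
    _ = ENNReal.ofReal 5 * ((∫⁻ z, ENNReal.ofReal (Xt z ^ 2) ∂localGibbsLaw σ a₀ u₀ θ₀ N (Φ N)) +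
          ((∫⁻ z, ENNReal.ofReal (X0 z ^ 2) ∂localGibbsLaw σ a₀ u₀ θ₀ N (Φ N)) +
          (ENNReal.ofReal ((η N * t) ^ 2) *
              ∫⁻ z, ENNReal.ofReal ((1 + en z) ^ 2) ∂localGibbsLaw σ a₀ u₀ θ₀ N (Φ N) +
          (ENNReal.ofReal (fs N ^ 2) + ENNReal.ofReal (res N ^ 2))))) := by
        rw [lintegral_const_mul' _ _ ENNReal.ofReal_ne_top, lintegral_add_left hXtm,
          lintegral_add_left hX0m, lintegral_add_left henm,
          lintegral_const_mul' _ _ ENNReal.ofReal_ne_top,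
          lintegral_add_left measurable_const, lintegral_const, lintegral_const, measure_univ,
          mul_one, mul_one]
    _ ≤ G N := by
        simp only [hG]
        gcongr
        exact hmom N


/-- **Registered form** (sub-goal `converse_residualAssembly` of the crux stmt-AtomisticToContinuum-14658, line `birth`): `residual_assembly` as a closed `∀`-statement — the `L²` converse of the duality assembly. [cite: PulvirentiSimonella2016, §2] -/
theorem converse_residualAssembly : ∀ {a₀ θ₀ : T3 → ℝ} {u₀ : T3 → V3} (ha : Continuous a₀) (hθ : Continuous θ₀) (hu : Continuous u₀) (ha0 : ∀ x, 0 < a₀ x) (hθ0 : ∀ x, 0 < θ₀ x) {σ : ℝ} (hσ : σ ≤ 1 / 2) (Φ : (N : ℕ) → HardSphereFlow (Torus.geometry (Fin 3)) (hsDiameter σ N) (N + 1)) {t : ℝ} (ht : 0 < t) (φ L : ℕ → ℝ → T3 → V3 → ℝ) (f : ℝ → T3 → V3 → ℝ) (Rres : (N : ℕ) → Config (N + 1) (Fin 3) T3 → ℝ) (hφc : ∀ N, Continuous fun p : ℝ × T3 × V3 => φ N p.1 p.2.1 p.2.2) (hreg : ∃ η : ℕ → ℝ, Tendsto η atTop (𝓝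 0) ∧ ∀ᶠ N in atTop, (∀ x v, ContDiffOn ℝ 1 (fun r => φ N r ((Torus.geometry (Fin 3)).translate x (r • v)) v) (Icc 0 t)) ∧ (∀ s ∈ Icc 0 t, ∀ x v, |derivWithin (fun r => φ N r ((Torus.geometry (Fin 3)).translate x ((r - s) • v)) v) (Icc 0 t) s + L N s x v| ≤ η N * (1 + ‖v‖ ^ 2))) (hL : ∀ N, ∃ K : ℝ, (∀ s ∈ Icc 0 t, ∀ x v, |L N s x v| ≤ K * (1 + ‖v‖ ^ 2) ^ 2) ∧ Measurable fun p : ℝ × T3 × V3 => L N (max 0 (min t p.1)) p.2.1 p.2.2) (hR : ∀ N z, Rres N z = ((N : ℝ) + 1)⁻¹ * (∑ᶠ (s : ℝ) (_ : s ∈ collisionTimes (Torus.geometry (Fin 3)) (hsDiameter σ N) (fun r => (Φ N).flow r z) ∩ Ioc 0 t), ∑ i : Fin (N + 1), ∑ j : Fin (N + 1), (if i ≠ j ∧ ‖(Torus.geometry (Fin 3)).sepVec ((Φ N).flow s z i).1 ((Φ N).flow s z j).1‖ = hsDiameter σ N then φ N s ((Φ N).flow s z i).1 ((Φ N).flow s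 z i).2 - φ N s ((Φ N).flow s z i).1 (reflectVel ((Torus.geometry (Fin 3)).sepVec ((Φ N).flow s z i).1 ((Φ N).flow s z j).1) (((Φ N).flow s z i).2, ((Φ N).flow s z j).2)).1 else 0)) - (∫ s in Icc 0 t, ∫ y, L N s y.1 y.2 ∂(empiricalMeasure ((Φ N).flow s z))) + (1 / 2 : ℝ) * ∫ s in Icc 0 t, ∫ x, ∫ v, f s x v * L N s x v) (hAt : Tendsto (fun N => ∫⁻ z, ENNReal.ofReal ((((N : ℝ) + 1)⁻¹ * (∑ i, φ N t ((Φ N).flow t z i).1 ((Φ N).flow t z i).2) - ∫ x, ∫ v, f t x v * φ N t x v) ^ 2) ∂localGibbsLaw σ a₀ u₀ θ₀ N (Φ N)) atTop (𝓝 0)) (hRes : Tendsto (fun N => (∫ x, ∫ v, f t x v * φ N t x v) - (∫ x, ∫ v, f 0 x v * φ N 0 x v) - ∫ s in Icc 0 t, ∫ x, ∫ v, f s x v * (derivWithin (fun r => φ N r ((Torus.geometry (Fin 3)).translate x ((r - s) • v)) v) (Icc 0 t) s + (1 / 2 : ℝ) * L N s x v)) atTop (𝓝 0)) (hF : Tendsto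 (fun N => (∫ s in Icc 0 t, ∫ x, ∫ v, f s x v * (derivWithin (fun r => φ N r ((Torus.geometry (Fin 3)).translate x ((r - s) • v)) v) (Icc 0 t) s + (1 / 2 : ℝ) * L N s x v)) + (1 / 2 : ℝ) * ∫ s in Icc 0 t, ∫ x, ∫ v, f s x v * L N s x v) atTop (𝓝 0)) (h0 : Tendsto (fun N => ∫⁻ z, ENNReal.ofReal ((((N : ℝ) + 1)⁻¹ * (∑ i, φ N 0 (z i).1 (z i).2) - ∫ x, ∫ v, f 0 x v * φ N 0 x v) ^ 2) ∂localGibbsLaw σ a₀ u₀ θ₀ N (Φ N)) atTop (𝓝 0)), Tendsto (fun N => ∫⁻ z, ENNReal.ofReal (Rres N z ^ 2) ∂localGibbsLaw σ a₀ u₀ θ₀ N (Φ N)) atTop (𝓝 0) :=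
  @residual_assembly

end Summit.AtomisticToContinuum.HydrodynamicLimit.Theorems

end
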